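import Summits.AnomalousDissipation.AnomalousDissipation.Theorems.TaylorWaveQuasiSteady.Negative.LoadBearing

/-!
# `NeutralTaylorWaves.TaylorWaveQuasiSteady` (stmt-AnomalousDissipation-16293): the work ceiling `ε₀² ≤ E‖f‖₂²`

Negative / tightness lemma (crux disprover, 2026-08-17) for the construction crux `TaylorWaveQuasiSteady`
(ONE smooth force `f`, `ν_n → 0⁺`; light `∫‖w‖² ≤ E`, loud `|ν_n‖∇w‖₂² − ε₀| ≤ C√ν_n`, quasi-steady
`‖(w·∇)w − ν_nΔw + ∇q − c∂₂w − f‖₂² ≤ Cν_n^K`), companion of `Negative/LoadBearing.lean`: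

* `taylorWaveQuasiSteady_work_ceiling` — the order-`1` clauses alone force `ε₀² ≤ E · ‖f‖₂²`: by the
  steady energy identity (`dissipation_sub_work_bound`) the dissipation is the work `∫⟪f, w_n⟫` up to
  `o(1)`, and `2t∫⟪f,w⟫ ≤ ‖f‖₂² + t²‖w‖₂²`. So LOUD-and-LIGHT is tight against the force: a witness needs
  energy budget `E ≥ ε₀²/‖f‖₂²`, with equality only if `w_n/‖w_n‖₂` aligns with `f/‖f‖₂` in `L²` — an
  `O(1)` part of every witness must correlate with the fixed smooth force while its gradients live at the
  Taylor scale `√ν_n`.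
-/

-- `Summit.<Summit>.<Problem>` is the tree's mandated summit-side namespace (CONVENTIONS §2); for this
-- single-conjunct summit the two coincide, so the duplicate is deliberate.
set_option linter.dupNamespace false

noncomputable section

open MeasureTheory Filter Topology
open scoped InnerProductSpace

namespace Summit.AnomalousDissipation.AnomalousDissipation.Theorems.TaylorWaveQuasiSteady.Negative

open Literature.Analysis.FunctionSpaces

/-- **Work ceiling (tightness of loud-and-light)** [negative lemma for
`NeutralTaylorWaves.TaylorWaveQuasiSteady`, stmt-AnomalousDissipation-16293]: the order-`1` clauses of
the crux (light `∫‖w‖² ≤ E`, loud `|ν_n‖∇w‖² − ε₀| ≤ C√ν_n`, residual `‖R_n‖₂² ≤ Cν_n`) already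
force `ε₀² ≤ E·‖f‖₂²`: by the steady energy identity the dissipation is the work `∫⟪f, w_n⟫` up to
`o(1)`, and `2t∫⟪f,w⟫ ≤ ‖f‖₂² + t²‖w‖₂²` for every `t ≥ 0`. So a witness needs energy
`E ≥ ε₀²/‖f‖₂²`; the bound is attained only if `w_n/‖w_n‖₂ → f/‖f‖₂` in `L²`. [folklore] -/
theorem taylorWaveQuasiSteady_work_ceiling
    (f : UnitAddTorus (Fin 3) → EuclideanSpace ℝ (Fin 3)) (hf : Torus.IsSmooth f)
    (ν : ℕ → ℝ) (E ε₀ : ℝ) (hν : ∀ n, 0 < ν n) (hν0 : Filter.Tendsto ν Filter.atTop (nhds 0))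
    (hε₀ : 0 < ε₀)
    (h1 : ∃ C : ℝ, ∀ n : ℕ, ∃ (w : UnitAddTorus (Fin 3) → EuclideanSpace ℝ (Fin 3))
        (q : UnitAddTorus (Fin 3) → ℝ) (c : ℝ),
        Torus.IsSmooth w ∧ Torus.IsSmooth q ∧ Torus.IsDivFree w ∧ Torus.HasZeroMean w ∧ |c| ≤ C ∧
        MeasureTheory.integral MeasureTheory.volume (fun x => ‖w x‖ ^ 2) ≤ E ∧
        |ν n * Torus.gradNormSq w - ε₀| ≤ C * Real.sqrt (ν n) ∧
        MeasureTheory.integral MeasureTheory.volume (fun x =>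
          ‖Torus.convect w w x - (ν n) • Torus.laplacian w x + Torus.gradient q x
            - c • Torus.partialDeriv (2 : Fin 3) w x - f x‖ ^ 2) ≤ C * (ν n) ^ (1 : ℕ)) :
    ε₀ ^ 2 ≤ E * ∫ x, ‖f x‖ ^ 2 := by
  obtain ⟨C, hC⟩ := h1
  set F : ℝ := ∫ x, ‖f x‖ ^ 2
  have hF0 : 0 ≤ F := integral_nonneg fun x => by positivity
  obtain ⟨w₀, q₀, c₀, -, -, -, -, hc₀, hE₀, -, -⟩ := hC 0
  have hC0 : 0 ≤ C := (abs_nonneg c₀).trans hc₀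
  have hE0 : 0 ≤ E := (integral_nonneg fun x => by positivity).trans hE₀
  -- Step 1: for every `t ≥ 0` and every `n`: `2t ε₀ ≤ F + t²E + (2tC + t(C + E)) √ν_n`
  have step : ∀ t : ℝ, 0 ≤ t → ∀ n : ℕ,
      2 * t * ε₀ ≤ F + t ^ 2 * E + (2 * t * C + t * (C + E)) * Real.sqrt (ν n) := by
    intro t ht n
    obtain ⟨w, q, c, hw, hq, hdiv, -, -, hEn, hDn, hRn⟩ := hC n
    set r : ℝ := Real.sqrt (ν n)
    have hr0 : 0 ≤ r := Real.sqrt_nonneg _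
    have hrpos : 0 < r := Real.sqrt_pos.2 (hν n)
    have hrr : r ^ 2 = ν n := Real.sq_sqrt (hν n).le
    rw [pow_one] at hRn
    have hE' : 0 ≤ ∫ x, ‖w x‖ ^ 2 := integral_nonneg fun x => by positivity
    -- energy inequality with `s = r`: `2r(νG − ∫⟪f,w⟫) ≤ ‖R‖² + r²‖w‖² ≤ r²(C + E)`
    have hB := dissipation_sub_work_bound hw hq hf hdiv (ν n) c (2 : Fin 3) hr0
    have hB' : 2 * r * (ν n * Torus.gradNormSq w - ∫ x, ⟪f x, w x⟫_ℝ) ≤ r ^ 2 * (C + E) := by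
      rw [hrr]
      nlinarith [hB, hRn, hEn, hE', mul_le_mul_of_nonneg_left hEn (sq_nonneg r)]
    have hB'' : 2 * (ν n * Torus.gradNormSq w - ∫ x, ⟪f x, w x⟫_ℝ) ≤ r * (C + E) := by
      nlinarith [hB', hrpos]
    -- Young for the work: `2t ∫⟪f,w⟫ ≤ F + t²E`
    have hY : ∀ x, 2 * t * ⟪f x, w x⟫_ℝ ≤ ‖f x‖ ^ 2 + t ^ 2 * ‖w x‖ ^ 2 := fun x =>
      two_mul_mul_inner_le (f x) (w x) ht
    have iYl : Integrable (fun x => 2 * t * ⟪f x, w x⟫_ℝ) volume :=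
      ((hf.inner hw).integrable).const_mul (2 * t)
    have iYr : Integrable (fun x => ‖f x‖ ^ 2 + t ^ 2 * ‖w x‖ ^ 2) volume :=
      hf.norm_sq.integrable.add (hw.norm_sq.integrable.const_mul _)
    have hmY := integral_mono iYl iYr hY
    rw [integral_const_mul, integral_add hf.norm_sq.integrable (hw.norm_sq.integrable.const_mul _),
      integral_const_mul] at hmY
    have hW : 2 * t * ∫ x, ⟪f x, w x⟫_ℝ ≤ F + t ^ 2 * E := by
      nlinarith [hmY, mul_le_mul_of_nonneg_left hEn (sq_nonneg t)]
    -- dissipation clause: `ε₀ ≤ νG + C r`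
    have hD : ε₀ ≤ ν n * Torus.gradNormSq w + C * r := by
      have := (abs_le.1 hDn).1
      linarith
    nlinarith [hW, hB'', hD, ht, hr0, hC0, hE0]
  -- Step 2: let `n → ∞`: `2t ε₀ ≤ F + t²E` for every `t ≥ 0`
  have limit : ∀ t : ℝ, 0 ≤ t → 2 * t * ε₀ ≤ F + t ^ 2 * E := by
    intro t ht
    by_contra hlt
    push Not at hlt
    set A : ℝ := 2 * t * C + t * (C + E) with hA
    have hA0 : 0 ≤ A := by rw [hA]; positivity
    -- pick `n` with `A √ν_n < gap`
    set gap : ℝ := 2 * t * ε₀ - (F + t ^ 2 * E) with hgap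
    have hgap0 : 0 < gap := by rw [hgap]; linarith
    obtain ⟨δ, hδ, hδA⟩ : ∃ δ : ℝ, 0 < δ ∧ δ * (A + 1) < gap :=
      ⟨gap / (A + 1) / 2, by positivity, by
        rw [div_mul_eq_mul_div, div_mul_cancel₀ _ (by positivity : (A + 1) ≠ 0)]; linarith⟩
    obtain ⟨n, hn⟩ : ∃ n, ν n < δ ^ 2 :=
      (hν0.eventually (gt_mem_nhds (by positivity))).exists
    have hrδ : Real.sqrt (ν n) < δ := (Real.sqrt_lt' hδ).2 hn
    have hs := step t ht n
    have : A * Real.sqrt (ν n) ≤ δ * (A + 1) := by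
      nlinarith [Real.sqrt_nonneg (ν n), hA0, hδ.le]
    linarith
  -- Step 3: optimise in `t`
  rcases eq_or_lt_of_le hE0 with hE | hE
  · -- `E = 0`: `2tε₀ ≤ F` for all `t` is absurd
    exfalso
    have h := limit ((F + 1) / (2 * ε₀)) (by positivity)
    rw [← hE, mul_zero, add_zero] at h
    have h' : 2 * ((F + 1) / (2 * ε₀)) * ε₀ = F + 1 := by
      field_simp
    linarith
  · -- `E > 0`: take `t = ε₀ / E`
    have ht : 0 ≤ ε₀ / E := div_nonneg hε₀.le hE.le
    have h := limit (ε₀ / E) ht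
    have hkey : 2 * (ε₀ / E) * ε₀ - (ε₀ / E) ^ 2 * E = ε₀ ^ 2 / E := by
      field_simp
      ring
    have h2 : ε₀ ^ 2 / E ≤ F := by linarith
    have h3 := (div_le_iff₀ hE).1 h2
    linarith [mul_comm F E]

end Summit.AnomalousDissipation.AnomalousDissipation.Theorems.TaylorWaveQuasiSteady.Negative

end
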